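import Summits.CriticalPhenomena.SAWScalingLimit.Theses.SAWBrickWallHomotopy
import Literature.Probability.RandomPlanarGeometry.ConformalRestrictionProofs
import Literature.Probability.RandomPlanarGeometry.CaratheodoryHalfPlaneProofs
import Literature.Probability.RandomPlanarGeometry.ZoomFlow
import HarnessLib

/-!
# Stub `stub_similarityIdentification` of line `pin-the-shear` (crux stmt-CriticalPhenomena-14221,
# `Theses.SAWPhaseRetrieval.HexTransfer`)

The line shows that the critical `δℤ²` SAW law of every Dobrushin domain `D` converges in law to
`Φ ∘ Γ_D` with `Γ_D` an SLE(8/3) curve of `Φ⁻¹(D)`, and pins `Φ` down to a similarity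
`S = similarity c hc 0 : z ↦ c z`. This file finishes: the image under `S` of an SLE(8/3) random
curve of `S⁻¹(D)` is an SLE(8/3) random curve of `S(S⁻¹(D)) = D` (`IsSLECurve.map` with
Carathéodory's boundary values `JordanDomain.exists_hasBoundaryValue_holds` and the similarity as a
conformal equivalence, `ChordalFamily.similarityConformalEquiv`; functoriality
`MarkedDomain.map_map`, `MarkedDomain.map_refl`), so the given `TendstoLaw` is already convergence
in law to chordal SLE(8/3) in `D`; the a.e.-measurability clause of `ConvergesInLawToSLE` is
automatic for the SAW (`SAW.aemeasurable_curve`).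

* `markedDomain_map_symm_map` : bookkeeping `(D.map φ.symm).map φ = D`;
* `isSLECurve_map_similarity` : similarity covariance of SLE_κ random curves;
* `stub_similarityIdentification` : the registered stub, verbatim.
-/

noncomputable section

namespace Summit.CriticalPhenomena.SAWScalingLimit.Cruxes.HexTransfer.PinTheShear

open MeasureTheory Filter Topology Set
open scoped NNReal
open Literature.Probability.RandomPlanarGeometry
open Literature.Probability.LatticeModels (Site)
open Literature.Probability (Process.preWienerMeasure)
open Summit.CriticalPhenomena.SAWScalingLimit.Theses

/-- `φ(φ⁻¹(D; x₁, …, xₙ)) = (D; x₁, …, xₙ)` for a plane homeomorphism `φ`. [folklore] -/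
theorem markedDomain_map_symm_map {n : ℕ} (D : MarkedDomain n) (φ : ℂ ≃ₜ ℂ) :
    (D.map φ.symm).map φ = D := by
  rw [MarkedDomain.map_map, Homeomorph.symm_trans_self, MarkedDomain.map_refl]

/-- **Similarity covariance of chordal SLE_κ random curves**: the image under the similarity
`S : z ↦ c z + w` (`c ≠ 0`) of a chordal SLE_κ random curve of `(D; a, b)` is a chordal SLE_κ
random curve of `(S D; S a, S b)` (`IsSLECurve.map` for the conformal equivalence `S|_D`, whose
boundary values are `S a`, `S b` by continuity; Carathéodory for the uniformizing map).
[folklore] -/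
theorem isSLECurve_map_similarity {κ : ℝ≥0} (D : DobrushinDomain) (c : ℂ) (hc : c ≠ 0) (w : ℂ)
    {Γ : (ℝ≥0 → ℝ) → CurveClass ℂ} (hΓ : IsSLECurve κ D Γ) :
    IsSLECurve κ (D.map (similarity c hc w))
      (CurveClass.map (similarity c hc w : C(ℂ, ℂ)) ∘ Γ) :=
  hΓ.map JordanDomain.exists_hasBoundaryValue_holds
    (ChordalFamily.similarityConformalEquiv c hc w D.carrier)
    (ChordalFamily.hasBoundaryValue_similarityConformalEquiv c hc w D.carrier (D.pt 0))
    (ChordalFamily.hasBoundaryValue_similarityConformalEquiv c hc w D.carrier (D.pt 1))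
    (fun _ _ => rfl)

/-- **Similarity identification** (stub of line `pin-the-shear`). If for a similarity `Φ z = c z`
(`c ≠ 0`) the critical `δℤ²` SAW law of every Dobrushin domain `D` converges in law to `Φ ∘ Γ_D`,
`Γ_D` an SLE(8/3) random curve of `Φ⁻¹(D)`, then `SAWScalingLimit`: `Φ ∘ Γ_D` is itself an
SLE(8/3) random curve of `Φ(Φ⁻¹(D)) = D` (`isSLECurve_map_similarity`,
`markedDomain_map_symm_map`), and the SAW observable is a.e.-measurable at every mesh
(`SAW.aemeasurable_curve`). [folklore] -/
theorem stub_similarityIdentification :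
    ∀ (c : ℂ) (hc : c ≠ 0),
      (∀ (D : DobrushinDomain) (a b : ℝ → Site 2), SAW.IsEndpointApprox D a b →
        ∃ Γ : (ℝ≥0 → ℝ) → CurveClass ℂ, IsSLECurve ((8 : ℝ≥0) / 3) (D.map (similarity c hc 0).symm) Γ ∧
          TendstoLaw (fun δ (γ : SAW.DomainSAW D.carrier δ (a δ) (b δ)) => γ.curve)
            (fun δ => SAW.law D.carrier δ (a δ) (b δ))
            (fun ω => CurveClass.map ((similarity c hc 0) : C(ℂ, ℂ)) (Γ ω)) Process.preWienerMeasure) →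
      _root_.SAWScalingLimit := by
  intro c hc hIL D a b hab
  obtain ⟨Γ, hΓ, hT⟩ := hIL D a b hab
  have hSLE : IsSLECurve ((8 : ℝ≥0) / 3) D (CurveClass.map (similarity c hc 0 : C(ℂ, ℂ)) ∘ Γ) := by
    have h := isSLECurve_map_similarity (D.map (similarity c hc 0).symm) c hc 0 hΓ
    rwa [markedDomain_map_symm_map] at h
  exact ⟨_, hSLE, Eventually.of_forall fun δ => SAW.aemeasurable_curve _ _ _ _, hT⟩

end Summit.CriticalPhenomena.SAWScalingLimit.Cruxes.HexTransfer.PinTheShear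

end
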